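/-
Copyright (c) 2026 the pub-hodgecm-mathlib formalisation cell (harness21).  Prover seat hodgecm-mathlib-LH4-p04 (g10), req620 Track A «(D-RAM) FOUR-FRAME» squad
((β₂) road (R-36), β₂-BOARD v3 row (L-Σ), brick (L-Σ-3B) ED. 3-1-ODD: the ABSTRACT window reduction of the ODD-d live row `2b + 1 = m`), 2026-09-05.
-/
import Summits.HodgeConjecture.HodgeConjecture.Theorems.F0P3cDyRamRowWindowReduction   -- ★ p862963 (LH4-p04 (g9)): the even-row kit; brings ★ p862919 `sum_range_ite_le_eq`, `sum_range_eq_sum_window`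
import HarnessLib

/-!
# Crux `H413`, line LH4 «(D-RAM) FOUR-FRAME» — (β₂) road, brick (L-Σ-3B) ED. 3-1-ODD: «THE ABSTRACT ROW-WINDOW REDUCTION ON THE ODD ROW» (pure `Finset` algebra over `ℤ`)

Cell `hodgecm-mathlib` (D-0151), FLOOR 0, crux item H413 = `stmt-HodgeConjecture-24833`, route of record `HCCMUnconditional`; squad F0∕P3c∕LH4; lane
`--supports stmt-HodgeConjecture-24833 --as helper` (count-neutral).  THEOREMS ONLY (no `def`, no instance, no notation, no `sorry`, default heartbeats).
WHY (β₂ WORD #18 parity ruling ∕ WORD #26).  At ODD cone depth `d` the live row of the β₂ cones is `2b + 1 = m` (★ `depth_mod_two_eq`: `m ≡ d (mod 2)`), and ‹ROW-ODD.letter.v1›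
(binder `hodd` of ★ p863096 `row₂_of_even_odd`) compares the two literals' guarded row sums filtered at `2b + 1 = m`.  THIS FILE is the odd twin of ★ p862963
`rowSum_eq_rowSum_of_window`: ABSTRACTLY (no lattice, no field), the comparison reduces to the WINDOWED identity
`Σ_{i < (jl−m)∕2+1} X_H (b+2i) b = Σ_{i < min ((jl−m)∕2+1) d} X_A (b+2i) b` at `2b + 1 = m`, `1 ≤ b`, GIVEN the same window vanishings (`j < b`; odd offset; beyond range
`jl < j + b`; for `X_A` the far cells `b + 2d ≤ j`), the same box bounds, AND the parity `(jl − m) % 2 = 0` (on the fence `jl ≡ d ≡ m`; it is what makes the last window cell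
`j + b = jl − 1` and the first discarded one `j + b = jl + 1`).  The census behind the identity: F0P3-p01 (g37) 2026-09-05T00:45:14Z, d = 3 type B, 8∕8 keys through δ = 12.
* `sum_filter_two_mul_add_one_eq` — the filter `2b + 1 = m` keeps at most the depth `b = m ∕ 2` (`m` odd);
* `sum_ite_eq_sum_window_odd` — one literal: guarded level sum at `2b + 1 = m` = its window sum;
* `rowSumOdd_eq_rowSumOdd_of_window` — the reduction; instantiated by `F0P3cDyRamRowOddOfCoreOdd :: rowOdd_of_coreOdd` at the two literals.
HONEST LABEL.  Arithmetic only; nothing printed is asserted; β₂ ∕ ‹ROW-ODD› ∕ ‹CORE-ODD› stay HYPOTHESES; `HC_CM` is proved only modulo the 7 printed citations (2 remaining named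
inputs: hLiu418 = `stmt-HodgeConjecture-24832`, h413 = `stmt-HodgeConjecture-24833`) until rung 0 closes.
References: [Kottwitz1986BaseChangeUnits] §1 pp. 240–241 (cell-by-cell lattice bookkeeping) · [Rogawski1990] §4.9 Prop. 4.9.1 (b) p. 55.
-/

set_option autoImplicit false

namespace Summit.HodgeConjecture.HodgeConjecture.Cruxes.H413.F0P3cDyRamRowWindowReductionOdd

open Finset Summit.HodgeConjecture.HodgeConjecture.Cruxes.H413.F0P3cDyRamRowSumWindowArithmetic

/-- **THE ODD-ROW FILTER KEEPS AT MOST ONE TUBE DEPTH.**  `Σ_{b ∈ S, 2b+1 = m} G b = if m % 2 = 1 ∧ m ∕ 2 ∈ S then G (m ∕ 2) else 0`.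
[cite: Kottwitz1986BaseChangeUnits, §1 pp. 240–241] -/
theorem sum_filter_two_mul_add_one_eq (S : Finset ℕ) (G : ℕ → ℤ) (m : ℕ) :
    ∑ b ∈ S.filter (fun b => 2 * b + 1 = m), G b = if m % 2 = 1 ∧ m / 2 ∈ S then G (m / 2) else 0 := by
  by_cases hpar : m % 2 = 1
  · have hS : S.filter (fun b => 2 * b + 1 = m) = S.filter (fun b => b = m / 2) :=
      filter_congr fun b _ => by omega
    rw [hS, filter_eq' S (m / 2)]
    by_cases hmem : m / 2 ∈ S
    · rw [if_pos hmem, if_pos ⟨hpar, hmem⟩, sum_singleton]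
    · rw [if_neg hmem, if_neg (fun h => hmem h.2), sum_empty]
  · rw [if_neg (fun h => hpar h.1)]
    exact sum_eq_zero fun b hb => absurd (mem_filter.1 hb).2 (by omega)

/-- **ONE LITERAL, ODD ROW: THE GUARDED LEVEL SUM AT TUBE DEPTH `b = (m−1)∕2` IS ITS WINDOW SUM** (`K` cells `j = b + 2i`; vanishing below `b`, at odd offset,
beyond `jl − b`, and — when `K` is cut at `d` — on the far cells `b + 2d ≤ j`; `δ = jl − m` even). [cite: Kottwitz1986BaseChangeUnits, §1 pp. 240–241] -/
theorem sum_ite_eq_sum_window_odd (P : ℕ → Prop) [DecidablePred P] (X : ℕ → ℕ → ℤ) {J jl m b K d : ℕ}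
    (hP : ∀ j, P j ↔ j ≤ jl) (hJ : jl ≤ J) (hmjl : m ≤ jl) (hδ : (jl - m) % 2 = 0) (hb : 2 * b + 1 = m)
    (hK : K = (jl - m) / 2 + 1 ∨ (K = min ((jl - m) / 2 + 1) d ∧ ∀ j, b + 2 * d ≤ j → (j - b) % 2 = 0 → X j b = 0))
    (h1 : ∀ j, j < b → X j b = 0) (h2 : ∀ j, b ≤ j → (j - b) % 2 = 1 → X j b = 0) (h3 : ∀ j, jl < j + b → X j b = 0) :
    ∑ j ∈ range (J + 1), (if P j then X j b else 0) = ∑ i ∈ range K, X (b + 2 * i) b := by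
  have hguard : ∑ j ∈ range (J + 1), (if P j then X j b else 0) = ∑ j ∈ range (J + 1), (if j ≤ jl then X j b else 0) :=
    sum_congr rfl fun j _ => by by_cases hj : j ≤ jl <;> simp [hj, hP j]
  have hKle : K ≤ (jl - m) / 2 + 1 := by
    rcases hK with hK | ⟨hK, -⟩
    · exact hK.le
    · rw [hK]; exact min_le_left _ _
  rw [hguard, sum_range_ite_le_eq _ hJ]
  refine sum_range_eq_sum_window (fun j => X j b) b K jl (fun i hi => by omega) fun j hj hnot => ?_
  rcases Nat.lt_or_ge j b with hjb | hbj
  · exact h1 j hjb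
  · by_cases hpar : (j - b) % 2 = 1
    · exact h2 j hbj hpar
    · -- `j = b + 2 i₀` with `i₀ = (j - b) / 2 ≥ K`
      have hi₀ : ¬ (j - b) / 2 < K := fun hlt => hnot _ hlt (by omega)
      rcases hK with hK | ⟨hK, hfar⟩
      · exact h3 j (by omega)
      · by_cases hfar' : b + 2 * d ≤ j
        · exact hfar j hfar' (by omega)
        · exact h3 j (by rw [hK] at hi₀; have := Nat.lt_min.not.1 hi₀; omega)

/-- **THE ABSTRACT ROW-WINDOW REDUCTION ON THE ODD ROW** — two families `X_H X_A`, common guard `P j ⟺ j ≤ jl` (`jl ≤ J`, `m ≤ jl`, `jl − m` even), window vanishings,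
box bounds, and the windowed identity at every `b` with `1 ≤ b`, `2b + 1 = m` ⟹ the two guarded row sums filtered at `2b + 1 = m` agree.
[cite: Kottwitz1986BaseChangeUnits, §1 pp. 240–241] [cite: Rogawski1990, §4.9 Prop. 4.9.1 (b) p. 55] -/
theorem rowSumOdd_eq_rowSumOdd_of_window (P : ℕ → Prop) [DecidablePred P] (XH XA : ℕ → ℕ → ℤ) (J R R' jl m d : ℕ)
    (hP : ∀ j, P j ↔ j ≤ jl) (hJ : jl ≤ J) (hmjl : m ≤ jl) (hδ : (jl - m) % 2 = 0)
    (h1H : ∀ b j, 1 ≤ b → 2 * b + 1 = m → j < b → XH j b = 0) (h2H : ∀ b j, 1 ≤ b → 2 * b + 1 = m → b ≤ j → (j - b) % 2 = 1 → XH j b = 0)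
    (h3H : ∀ b j, 1 ≤ b → 2 * b + 1 = m → jl < j + b → XH j b = 0) (hRH : ∀ b j, 1 ≤ b → 2 * b + 1 = m → P j → XH j b ≠ 0 → b ≤ R)
    (h1A : ∀ b j, 1 ≤ b → 2 * b + 1 = m → j < b → XA j b = 0) (h2A : ∀ b j, 1 ≤ b → 2 * b + 1 = m → b ≤ j → (j - b) % 2 = 1 → XA j b = 0)
    (h3A : ∀ b j, 1 ≤ b → 2 * b + 1 = m → jl < j + b → XA j b = 0) (h4A : ∀ b j, 1 ≤ b → 2 * b + 1 = m → b + 2 * d ≤ j → (j - b) % 2 = 0 → XA j b = 0)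
    (hRA : ∀ b j, 1 ≤ b → 2 * b + 1 = m → P j → XA j b ≠ 0 → b ≤ R')
    (hcore : ∀ b, 1 ≤ b → 2 * b + 1 = m →
      ∑ i ∈ range ((jl - m) / 2 + 1), XH (b + 2 * i) b = ∑ i ∈ range (min ((jl - m) / 2 + 1) d), XA (b + 2 * i) b) :
    ∑ b ∈ (Icc 1 R).filter (fun b => 2 * b + 1 = m), ∑ j ∈ range (J + 1), (if P j then XH j b else 0) =
      ∑ b ∈ (Icc 1 R').filter (fun b => 2 * b + 1 = m), ∑ j ∈ range (J + 1), (if P j then XA j b else 0) := by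
  rw [sum_filter_two_mul_add_one_eq, sum_filter_two_mul_add_one_eq]
  by_cases hpar : m % 2 = 1
  swap
  · rw [if_neg (fun h => hpar h.1), if_neg (fun h => hpar h.1)]
  have hb : 2 * (m / 2) + 1 = m := by omega
  by_cases hb1 : 1 ≤ m / 2
  swap
  · have hH : m / 2 ∉ Icc 1 R := fun h => hb1 (mem_Icc.1 h).1
    have hA : m / 2 ∉ Icc 1 R' := fun h => hb1 (mem_Icc.1 h).1
    rw [if_neg (fun h => hH h.2), if_neg (fun h => hA h.2)]
  -- both guarded row sums are their window sums, which agree by `hcore`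
  have eH := sum_ite_eq_sum_window_odd P XH (J := J) (d := d) hP hJ hmjl hδ hb (Or.inl rfl)
    (fun j hj => h1H _ j hb1 hb hj) (fun j hj hp => h2H _ j hb1 hb hj hp) (fun j hj => h3H _ j hb1 hb hj)
  have eA := sum_ite_eq_sum_window_odd P XA (J := J) hP hJ hmjl hδ hb (Or.inr ⟨rfl, fun j hj hp => h4A _ j hb1 hb hj hp⟩)
    (fun j hj => h1A _ j hb1 hb hj) (fun j hj hp => h2A _ j hb1 hb hj hp) (fun j hj => h3A _ j hb1 hb hj)
  have key : ∑ j ∈ range (J + 1), (if P j then XH j (m / 2) else 0) = ∑ j ∈ range (J + 1), (if P j then XA j (m / 2) else 0) := by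
    rw [eH, eA]; exact hcore _ hb1 hb
  -- outside a box the guarded row sum vanishes termwise (box bound), on either side
  have zH : m / 2 ∉ Icc 1 R → ∑ j ∈ range (J + 1), (if P j then XH j (m / 2) else 0) = 0 := fun hn =>
    sum_eq_zero fun j _ => by
      split_ifs with hp
      · by_contra hne; exact hn (mem_Icc.2 ⟨hb1, hRH _ j hb1 hb hp hne⟩)
      · rfl
  have zA : m / 2 ∉ Icc 1 R' → ∑ j ∈ range (J + 1), (if P j then XA j (m / 2) else 0) = 0 := fun hn =>
    sum_eq_zero fun j _ => by
      split_ifs with hp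
      · by_contra hne; exact hn (mem_Icc.2 ⟨hb1, hRA _ j hb1 hb hp hne⟩)
      · rfl
  by_cases hH : m / 2 ∈ Icc 1 R <;> by_cases hA : m / 2 ∈ Icc 1 R'
  · rw [if_pos ⟨hpar, hH⟩, if_pos ⟨hpar, hA⟩]; exact key
  · rw [if_pos ⟨hpar, hH⟩, if_neg (fun h => hA h.2), key]; exact zA hA
  · rw [if_neg (fun h => hH h.2), if_pos ⟨hpar, hA⟩, ← key]; exact (zH hH).symm
  · rw [if_neg (fun h => hH h.2), if_neg (fun h => hA h.2)]

end Summit.HodgeConjecture.HodgeConjecture.Cruxes.H413.F0P3cDyRamRowWindowReductionOdd
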